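import Literature.Topology.FourManifolds.RegularInterval
import Literature.Topology.FourManifolds.FlowsProofs
import Literature.Topology.FourManifolds.RegularLevelSet
import Mathlib.Geometry.Manifold.Immersion
import HarnessLib

/-!
# The product neighbourhood of a regular level of a function on a closed manifold
# (Milnor 1963, Thm. 3.1; Milnor 1965, Thm. 3.4: `f⁻¹(a - δ, a + δ) ≅ f⁻¹(a) × (-δ, δ)`)

Topic `Literature/Topology/FourManifolds`; infrastructure for the fact seat
`provefact-Literature.Topology.FourManifolds.exists_isBalancedGKTrisection` (Gay–Kirby 2016,
Thm. 4: the sectors of the trisection of Lemma 14 are cut out of the closed `4`-manifold by a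
Morse function `f` and, inside the level `∂X₁ = f⁻¹(3/2)`, by a Heegaard splitting; their
corner charts along the central surface `F` — `Literature.Topology.FourManifolds.CornerSliceChart`
of `TrisectionsSectorAtlas.lean` — need *product coordinates* `(s, r, z) ∈ ℝ × ℝ × F` near `F`,
which are obtained by composing the product neighbourhood of the level `f = 3/2` in `X` with
the product neighbourhood of the level of the Heegaard function in `f⁻¹(3/2)`).  Everything in
this file is **proved**; no named facts are introduced.

**The statement.**  Milnor, *Morse theory* (1963), proof of Thm. 3.1 (with Matsumoto, *An
introduction to Morse theory* (2001), Thm. 2.31, pp. 74–75): choose a smooth vector field `X`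
with `X(f) = 1` on a neighbourhood `f⁻¹[a - δ, b + δ]` of `f⁻¹[a, b]` and let `φ_t` be its
flow; *"for fixed `q`, `t ↦ f(φ_t(q))` has derivative `1` as long as `f(φ_t(q))` lies between
`a` and `b`"*.  Milnor, *Lectures on the h-cobordism theorem* (1965), Thm. 3.4 and its proof
(PDF pp. 12–13): the integral curves `ψ_y(s)` of `ξ/ξ(f)`, normalised so that
`f(ψ_y(s)) = s`, give the diffeomorphism `h(y₀, s) = ψ_{y₀}(s)` of `V₀ × [0, 1]` onto `W`,
with inverse `h⁻¹(y) = (ψ_y(0), f(y))`.  Here, for a smooth function `f` on a **compact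
manifold without boundary** `M` (model `𝓡 (n + 1)`) and a level `a` carrying no critical point:

* `Literature.Topology.FourManifolds.LevelUnitField n f a` — the data of a smooth vector field
  `ξ` on `M` with `ξ(f) = 1` on a band `f⁻¹[a - δ, a + δ]`, `δ > 0` (existence for a regular
  level: `IsRegularLevel.exists_levelUnitField`, from `RegularSlabField.lean`);
* for such a field `U`: its global flow `U.fl x t` (`FlowsProofs.lean`, `flow`), **the clock**
  `f (U.fl x t) = f x + t` as long as both values lie in the open band `(a - δ, a + δ)`
  (`LevelUnitField.apply_fl_eq_add`; the real-variable heart is `Literature.UnitSpeed` of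
  `RegularInterval.lean`, run forwards and, by time reversal, backwards);
* **the drop onto the level** `U.drop x = U.fl x (a - f x)` — Milnor's `ψ_y(0)` —: smooth on
  all of `M` (`contMDiff_drop`), equal to the identity on the level, landing on the level from
  every point of the open band (`apply_drop`), invariant along the flow inside the band
  (`drop_fl`), and inverting the flow-out of the level (`fl_drop`, `drop_fl_of_apply_eq`);
* **the product chart** `LevelUnitField.collarChart U h` — Milnor's `h(y₀, s) = ψ_{y₀}(s)` with
  inverse `y ↦ (ψ_y(0), f y - a)` — as an open partial homeomorphism from
  `f⁻¹(a) × ℝ` (the level as the manifold `Literature.Topology.FourManifolds.RegularLevel h` of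
  `RegularLevelSet.lean`, times `ℝ`) to `M`, with source `f⁻¹(a) × (-δ, δ)` and target the open
  band, `C^∞` with `C^∞` inverse for the product model `(𝓡 n).prod 𝓘(ℝ, ℝ)`
  (`contMDiffOn_collarChart`, `contMDiffOn_collarChart_symm`; the level component of the
  inverse is smooth as a map *into the level* because the inclusion of the level is a smooth
  embedding, Mathlib's `ContMDiffAt.iff_comp_isImmersionAt`), and `f = a + s` in the chart
  (`apply_collarChart`).

## References

* J. Milnor, *Morse theory*, Ann. of Math. Studies 51 (1963), Thm. 3.1 and its proof.
  [Milnor1963]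
* J. Milnor, *Lectures on the h-cobordism theorem*, Princeton (1965), Thm. 3.4 and its proof
  (PDF pp. 12–13 of the held copy). [MilnorHCobordism1965]
* Y. Matsumoto, *An introduction to Morse theory*, Transl. Math. Monogr. 208 (2001), Thm. 2.31
  (pp. 74–75). [Matsumoto2001]
* J. M. Lee, *Introduction to Smooth Manifolds*, 2nd ed. (2012), Thm. 9.12 (flows).
  [LeeSmoothManifolds2013]
-/

open scoped Manifold ContDiff Topology
open Set Function

noncomputable section

universe u

namespace Literature.Topology.FourManifolds

/-- Local notation: `𝔼 n` is the model Euclidean space `EuclideanSpace ℝ (Fin n)`. -/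
local notation "𝔼 " n:arg => EuclideanSpace ℝ (Fin n)

variable {n : ℕ} {M : Type u} [TopologicalSpace M] [T2Space M]
  [CompactSpace M] [ChartedSpace (𝔼 (n + 1)) M] [IsManifold (𝓡 (n + 1)) ∞ M]

/-! ### Unit-speed fields across a level -/

/-- A **unit-speed field across the level `a`** of `f`: a smooth vector field `ξ` on `M` with
`ξ(f) = 1` on the band `f⁻¹[a - δ, a + δ]`, `δ > 0`, for a smooth `f` (Milnor 1963, proof of
Thm. 3.1: "`⟨X, grad f⟩ = 1` throughout `f⁻¹[a, b]`"; Milnor 1965, proof of Thm. 3.4: the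
normalised field `ξ/ξ(f)`). [cite: Milnor1963, proof of Thm. 3.1] -/
structure LevelUnitField (n : ℕ) {M : Type u} [TopologicalSpace M] [ChartedSpace (𝔼 (n + 1)) M]
    [IsManifold (𝓡 (n + 1)) ∞ M] (f : M → ℝ) (a : ℝ) where
  /-- The vector field. -/
  ξ : Π x : M, TangentSpace (𝓡 (n + 1)) x
  /-- It is smooth. -/
  contMDiff : ContMDiff (𝓡 (n + 1)) (𝓡 (n + 1)).tangent ∞ fun x => (⟨x, ξ x⟩ : TangentBundle (𝓡 (n + 1)) M)
  /-- The function is smooth. -/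
  contMDiff_f : ContMDiff (𝓡 (n + 1)) 𝓘(ℝ, ℝ) ∞ f
  /-- The half-width of the band. -/
  δ : ℝ
  /-- The band has positive width. -/
  δ_pos : 0 < δ
  /-- Unit speed across the band: `ξ(f) = 1` on `f⁻¹[a - δ, a + δ]`. -/
  mlineDeriv_eq_one : ∀ x, f x ∈ Icc (a - δ) (a + δ) → mlineDeriv (𝓡 (n + 1)) f x (ξ x) = 1

/-- **A regular level carries a unit-speed field across it** (Milnor 1963, proof of Thm. 3.1;
the tree's `Literature.Topology.FourManifolds.exists_contMDiffSection_mlineDeriv_eq_one_slab`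
with `a = b`: the level contains no critical point, so neither does a thin band around it, by
compactness). [cite: Milnor1963, proof of Thm. 3.1] -/
theorem IsRegularLevel.exists_levelUnitField {f : M → ℝ} {a : ℝ} (h : IsRegularLevel (𝓡 (n + 1)) f a) :
    Nonempty (LevelUnitField n f a) := by
  have hreg : ∀ x, f x ∈ Icc a a → mfderiv (𝓡 (n + 1)) 𝓘(ℝ, ℝ) f x ≠ 0 := fun x hx =>
    h.not_isMCriticalPt (le_antisymm hx.2 hx.1)
  obtain ⟨ξ, δ, hδ, hξ⟩ := exists_contMDiffSection_mlineDeriv_eq_one_slab h.contMDiff hreg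
  exact ⟨⟨fun x => ξ x, ξ.contMDiff, h.contMDiff, δ, hδ, hξ⟩⟩

namespace LevelUnitField

variable {f : M → ℝ} {a : ℝ} (U : LevelUnitField n f a)

/-! ### The flow and the clock -/

/-- The global flow of the unit-speed field (`Literature.Topology.FourManifolds.flow`).
[cite: LeeSmoothManifolds2013, Thm. 9.12] -/
def fl (x : M) (t : ℝ) : M := flow U.contMDiff x t

/-- The flow starts at the given point. [cite: LeeSmoothManifolds2013, Thm. 9.12] -/
@[simp] theorem fl_zero (x : M) : U.fl x 0 = x := flow_zero U.contMDiff x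

/-- The group law of the flow. [cite: LeeSmoothManifolds2013, Thm. 9.12] -/
theorem fl_add (x : M) (s t : ℝ) : U.fl x (s + t) = U.fl (U.fl x s) t := flow_add U.contMDiff x s t

/-- `fl (-t)` undoes `fl t`. [cite: LeeSmoothManifolds2013, Thm. 9.12] -/
theorem fl_neg_fl (x : M) (t : ℝ) : U.fl (U.fl x t) (-t) = x := flow_neg_flow U.contMDiff x t

/-- The flow is smooth jointly in `(x, t)`. [cite: LeeSmoothManifolds2013, Thm. 9.12] -/
theorem contMDiff_fl : ContMDiff ((𝓡 (n + 1)).prod 𝓘(ℝ, ℝ)) (𝓡 (n + 1)) ∞ fun p : M × ℝ => U.fl p.1 p.2 :=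
  (contMDiff_flow U.contMDiff).comp (contMDiff_snd.prodMk contMDiff_fst)

/-- The flow is continuous jointly in `(x, t)`. [cite: LeeSmoothManifolds2013, Thm. 9.12] -/
theorem continuous_fl : Continuous fun p : M × ℝ => U.fl p.1 p.2 := U.contMDiff_fl.continuous

/-- Each time-`t` map of the flow is smooth. [cite: LeeSmoothManifolds2013, Thm. 9.12] -/
theorem contMDiff_fl_apply (t : ℝ) : ContMDiff (𝓡 (n + 1)) (𝓡 (n + 1)) ∞ fun x => U.fl x t :=
  U.contMDiff_fl.comp (contMDiff_id.prodMk contMDiff_const)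

/-- Along a flow line, `t ↦ f (fl x t)` has derivative `ξ(f)` at the current point.
[cite: Milnor1963, proof of Thm. 3.1] -/
theorem hasDerivAt_comp_fl (x : M) (t : ℝ) :
    HasDerivAt (fun t => f (U.fl x t)) (mlineDeriv (𝓡 (n + 1)) f (U.fl x t) (U.ξ (U.fl x t))) t :=
  hasDerivAt_comp_integralCurve U.contMDiff_f (isMIntegralCurve_flow U.contMDiff x) t

/-- In the open band, the derivative of `t ↦ f (fl x t)` is `1`. [cite: Milnor1963, proof of Thm. 3.1] -/
theorem deriv_eq_one_of_mem_band (x : M) (t : ℝ) (ht : f (U.fl x t) ∈ Ioo (a - U.δ) (a + U.δ)) :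
    mlineDeriv (𝓡 (n + 1)) f (U.fl x t) (U.ξ (U.fl x t)) = 1 :=
  U.mlineDeriv_eq_one _ ⟨ht.1.le, ht.2.le⟩

/-- **The clock, forwards**: `f (fl x t) = f x + t` for `t ≥ 0` as long as the values stay in
the open band (*"`t ↦ f(φ_t(q))` has derivative `1` as long as `f(φ_t(q))` lies between `a`
and `b`"*). [cite: Milnor1963, proof of Thm. 3.1] -/
theorem apply_fl_eq_add_of_nonneg {x : M} {t : ℝ} (ht : 0 ≤ t) (hx : a - U.δ < f x)
    (hxt : f x + t < a + U.δ) : f (U.fl x t) = f x + t := by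
  have key := UnitSpeed.eq_add_of_deriv_eq_one (g := fun t => f (U.fl x t))
    (g' := fun t => mlineDeriv (𝓡 (n + 1)) f (U.fl x t) (U.ξ (U.fl x t)))
    (U.hasDerivAt_comp_fl x) (fun t ht => U.deriv_eq_one_of_mem_band x t ht) (t₀ := 0) (T := t)
    (by simpa using hx) (by simpa using hxt) t ⟨ht, le_rfl⟩
  simpa using key

/-- **The clock, backwards**: `f (fl x t) = f x + t` for `t ≤ 0` as long as the values stay in
the open band (time reversal of the forward clock). [cite: Milnor1963, proof of Thm. 3.1] -/
theorem apply_fl_eq_add_of_nonpos {x : M} {t : ℝ} (ht : t ≤ 0) (hx : f x < a + U.δ)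
    (hxt : a - U.δ < f x + t) : f (U.fl x t) = f x + t := by
  set g : ℝ → ℝ := fun t => f (U.fl x t) with hg
  set g' : ℝ → ℝ := fun t => mlineDeriv (𝓡 (n + 1)) f (U.fl x t) (U.ξ (U.fl x t)) with hg'
  have hderiv : ∀ t, HasDerivAt g (g' t) t := U.hasDerivAt_comp_fl x
  have hband : ∀ t, g t ∈ Ioo (a - U.δ) (a + U.δ) → g' t = 1 := fun t ht => U.deriv_eq_one_of_mem_band x t ht
  have hGderiv := UnitSpeed.hasDerivAt_neg_comp_sub hderiv 0
  have hGband := UnitSpeed.band_neg_comp_sub hband 0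
  have hg0 : g 0 = f x := by simp [hg]
  have key := UnitSpeed.eq_add_of_deriv_eq_one hGderiv hGband (t₀ := 0) (T := -t)
    (by simp only [sub_zero, hg0]; linarith) (by simp only [sub_zero, hg0]; linarith) (-t) ⟨by linarith, le_rfl⟩
  simp only [zero_add, sub_zero, hg0, zero_sub, neg_neg] at key
  have : g t = f x + t := by linarith
  exact this

/-- **The clock**: `f (fl x t) = f x + t` whenever `f x` and `f x + t` both lie in the open band
`(a - U.δ, a + U.δ)`. [cite: Milnor1963, proof of Thm. 3.1] -/
theorem apply_fl_eq_add {x : M} {t : ℝ} (hx : f x ∈ Ioo (a - U.δ) (a + U.δ))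
    (hxt : f x + t ∈ Ioo (a - U.δ) (a + U.δ)) : f (U.fl x t) = f x + t := by
  rcases le_total 0 t with ht | ht
  · exact U.apply_fl_eq_add_of_nonneg ht hx.1 hxt.2
  · exact U.apply_fl_eq_add_of_nonpos ht hx.2 hxt.1

/-- From the level, the flow reaches height `a + s` at time `s ∈ (-δ, δ)`
(`f (ψ_y(s)) = a + s`). [cite: MilnorHCobordism1965, proof of Thm. 3.4] -/
theorem apply_fl_of_apply_eq {y : M} (hy : f y = a) {s : ℝ} (hs : s ∈ Ioo (-U.δ) U.δ) :
    f (U.fl y s) = a + s := by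
  have h := U.apply_fl_eq_add (x := y) (t := s)
    (by rw [hy]; exact ⟨by linarith [U.δ_pos], by linarith [U.δ_pos]⟩)
    (by rw [hy]; exact ⟨by linarith [hs.1], by linarith [hs.2]⟩)
  rw [hy] at h
  exact h

/-! ### The open band and the drop onto the level -/

/-- The open band `f⁻¹(a - U.δ, a + U.δ)` around the level. [cite: Milnor1963, proof of Thm. 3.1] -/
def band : Set M := f ⁻¹' Ioo (a - U.δ) (a + U.δ)

omit [T2Space M] [CompactSpace M] in
/-- Membership in the band (definitional). [folklore] -/
theorem mem_band_iff {x : M} : x ∈ U.band ↔ f x ∈ Ioo (a - U.δ) (a + U.δ) := Iff.rfl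

omit [T2Space M] [CompactSpace M] in
/-- The band is open. [folklore] -/
theorem isOpen_band : IsOpen U.band := isOpen_Ioo.preimage U.contMDiff_f.continuous

omit [T2Space M] [CompactSpace M] in
/-- The level lies in the band. [folklore] -/
theorem mem_band_of_apply_eq {y : M} (hy : f y = a) : y ∈ U.band := by
  rw [mem_band_iff, hy]; exact ⟨by linarith [U.δ_pos], by linarith [U.δ_pos]⟩

/-- The flow-out of the level for times in `(-δ, δ)` stays in the band. [cite: MilnorHCobordism1965, proof of Thm. 3.4] -/
theorem fl_mem_band {y : M} (hy : f y = a) {s : ℝ} (hs : s ∈ Ioo (-U.δ) U.δ) : U.fl y s ∈ U.band := by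
  rw [mem_band_iff, U.apply_fl_of_apply_eq hy hs]
  exact ⟨by linarith [hs.1], by linarith [hs.2]⟩

/-- **The drop onto the level** along the flow: `drop x = fl x (a - f x)` (Milnor's `ψ_y(0)`,
the level component of the inverse of the product chart). [cite: MilnorHCobordism1965, proof of Thm. 3.4] -/
def drop (x : M) : M := U.fl x (a - f x)

/-- The drop is smooth on all of `M` (flow composed with `x ↦ (x, a - f x)`).
[cite: MilnorHCobordism1965, proof of Thm. 3.4] -/
theorem contMDiff_drop : ContMDiff (𝓡 (n + 1)) (𝓡 (n + 1)) ∞ U.drop :=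
  U.contMDiff_fl.comp (contMDiff_id.prodMk (contMDiff_const.sub U.contMDiff_f))

/-- The drop is continuous. [folklore] -/
theorem continuous_drop : Continuous U.drop := U.contMDiff_drop.continuous

/-- **From the band, the drop lands on the level**: `f (drop x) = a`.
[cite: MilnorHCobordism1965, proof of Thm. 3.4] -/
theorem apply_drop {x : M} (hx : x ∈ U.band) : f (U.drop x) = a := by
  rw [drop, U.apply_fl_eq_add hx (by rw [add_sub_cancel]; exact ⟨by linarith [U.δ_pos], by linarith [U.δ_pos]⟩)]
  ring

/-- On the level the drop is the identity. [cite: MilnorHCobordism1965, proof of Thm. 3.4] -/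
theorem drop_of_apply_eq {y : M} (hy : f y = a) : U.drop y = y := by
  rw [drop, hy, sub_self, fl_zero]

/-- Flowing the drop back up for time `f x - a` returns `x` (on the band, and in fact
everywhere, by the group law). [cite: MilnorHCobordism1965, proof of Thm. 3.4] -/
theorem fl_drop (x : M) : U.fl (U.drop x) (f x - a) = x := by
  rw [drop, ← fl_add, show a - f x + (f x - a) = 0 by ring, fl_zero]

/-- **The drop is constant along the flow inside the band**: `drop (fl x t) = drop x` when
`f x` and `f x + t` lie in the open band. [cite: MilnorHCobordism1965, proof of Thm. 3.4] -/
theorem drop_fl {x : M} {t : ℝ} (hx : x ∈ U.band) (hxt : f x + t ∈ Ioo (a - U.δ) (a + U.δ)) :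
    U.drop (U.fl x t) = U.drop x := by
  rw [drop, drop, U.apply_fl_eq_add hx hxt, ← fl_add]
  congr 1
  ring

/-- Dropping the flow-out of a point of the level returns that point (`ψ_{ψ_y(s)}(0) = y`).
[cite: MilnorHCobordism1965, proof of Thm. 3.4] -/
theorem drop_fl_of_apply_eq {y : M} (hy : f y = a) {s : ℝ} (hs : s ∈ Ioo (-U.δ) U.δ) :
    U.drop (U.fl y s) = y := by
  rw [U.drop_fl (U.mem_band_of_apply_eq hy) (by rw [hy]; exact ⟨by linarith [hs.1], by linarith [hs.2]⟩),
    U.drop_of_apply_eq hy]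

/-- The drop maps the band onto the level. [cite: MilnorHCobordism1965, proof of Thm. 3.4] -/
theorem drop_mem_level {x : M} (hx : x ∈ U.band) : U.drop x ∈ f ⁻¹' {a} := U.apply_drop hx

/-- **The flow-out of the level is injective on `f⁻¹(a) × (-δ, δ)`.**
[cite: MilnorHCobordism1965, proof of Thm. 3.4] -/
theorem fl_injOn : InjOn (fun p : M × ℝ => U.fl p.1 p.2) ((f ⁻¹' {a}) ×ˢ Ioo (-U.δ) U.δ) := by
  rintro ⟨y, s⟩ ⟨hy, hs⟩ ⟨y', s'⟩ ⟨hy', hs'⟩ heq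
  have hy₀ : f y = a := hy
  have hy₀' : f y' = a := hy'
  have hss : s = s' := by
    have h1 := U.apply_fl_of_apply_eq hy₀ hs
    have h2 := U.apply_fl_of_apply_eq hy₀' hs'
    have : f (U.fl y s) = f (U.fl y' s') := by rw [show U.fl y s = U.fl y' s' from heq]
    linarith
  subst hss
  have : U.drop (U.fl y s) = U.drop (U.fl y' s) := by rw [show U.fl y s = U.fl y' s from heq]
  rw [U.drop_fl_of_apply_eq hy₀ hs, U.drop_fl_of_apply_eq hy₀' hs] at this
  rw [this]

/-- **The flow-out of `f⁻¹(a) × (-δ, δ)` is exactly the open band** (surjectivity: `x` in the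
band is `fl (drop x) (f x - a)`). [cite: MilnorHCobordism1965, proof of Thm. 3.4] -/
theorem image_fl_eq_band : (fun p : M × ℝ => U.fl p.1 p.2) '' ((f ⁻¹' {a}) ×ˢ Ioo (-U.δ) U.δ) = U.band := by
  refine Subset.antisymm ?_ fun x hx => ?_
  · rintro _ ⟨⟨y, s⟩, ⟨hy, hs⟩, rfl⟩
    exact U.fl_mem_band hy hs
  · refine ⟨(U.drop x, f x - a), ⟨U.drop_mem_level hx, ?_⟩, U.fl_drop x⟩
    have h1 : a - U.δ < f x := hx.1
    have h2 : f x < a + U.δ := hx.2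
    exact ⟨by show -U.δ < f x - a; linarith, by show f x - a < U.δ; linarith⟩

/-! ### The product chart `f⁻¹(a) × (-δ, δ) ≅ f⁻¹(a - δ, a + δ)` -/

section Chart

variable (h : IsRegularLevel (𝓡 (n + 1)) f a)

open Classical in
/-- The drop, lifted to the level manifold `RegularLevel h` (the junk value
`Classical.arbitrary` off the band, where the drop need not land on the level).
[cite: MilnorHCobordism1965, proof of Thm. 3.4] -/
def dropLift [Nonempty (RegularLevel h)] (x : M) : RegularLevel h :=
  if hx : f (U.drop x) = a then ⟨U.drop x, hx⟩ else Classical.arbitrary _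

/-- On the band, the lifted drop is the drop. [cite: MilnorHCobordism1965, proof of Thm. 3.4] -/
theorem incl_dropLift [Nonempty (RegularLevel h)] {x : M} (hx : x ∈ U.band) :
    RegularLevel.incl h (U.dropLift h x) = U.drop x := by
  have hx' : f (U.drop x) = a := U.apply_drop hx
  simp only [dropLift, hx', ↓reduceDIte]

/-- On the band, `incl ∘ dropLift = drop` eventually (the band is open). [folklore] -/
theorem incl_comp_dropLift_eventuallyEq [Nonempty (RegularLevel h)] {x : M} (hx : x ∈ U.band) :
    (RegularLevel.incl h ∘ U.dropLift h) =ᶠ[𝓝 x] U.drop := by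
  filter_upwards [U.isOpen_band.mem_nhds hx] with z hz
  exact U.incl_dropLift h hz

/-- **The lifted drop is smooth on the band, as a map into the level manifold**: its composite
with the inclusion of the level — a smooth embedding — is the smooth map `drop`
(Mathlib's `ContMDiffAt.iff_comp_isImmersionAt`). [cite: MilnorHCobordism1965, proof of Thm. 3.4] -/
theorem contMDiffAt_dropLift [Nonempty (RegularLevel h)] {x : M} (hx : x ∈ U.band) :
    ContMDiffAt (𝓡 (n + 1)) (𝓡 n) ∞ (U.dropLift h) x := by
  have hι := RegularLevel.isSmoothEmbedding_incl h
  have hcomp : ContMDiffAt (𝓡 (n + 1)) (𝓡 (n + 1)) ∞ (RegularLevel.incl h ∘ U.dropLift h) x :=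
    U.contMDiff_drop.contMDiffAt.congr_of_eventuallyEq (U.incl_comp_dropLift_eventuallyEq h hx)
  have hcont : ContinuousAt (U.dropLift h) x := by
    rw [hι.isEmbedding.isInducing.continuousAt_iff]
    exact hcomp.continuousAt
  exact (ContMDiffAt.iff_comp_isImmersionAt (hι.isImmersion.isImmersionAt _)).2 ⟨hcont, hcomp⟩

/-- The lifted drop is smooth on the band. [cite: MilnorHCobordism1965, proof of Thm. 3.4] -/
theorem contMDiffOn_dropLift [Nonempty (RegularLevel h)] :
    ContMDiffOn (𝓡 (n + 1)) (𝓡 n) ∞ (U.dropLift h) U.band := fun _ hx =>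
  (U.contMDiffAt_dropLift h hx).contMDiffWithinAt

/-- **The product chart of the level** (Milnor's `h(y₀, s) = ψ_{y₀}(s)`,
`h⁻¹(y) = (ψ_y(0), f y - a)`): the flow-out `(y, s) ↦ fl y s` as an open partial homeomorphism
from `f⁻¹(a) × ℝ` to `M` with source `f⁻¹(a) × (-δ, δ)` and target the open band
`f⁻¹(a - U.δ, a + U.δ)`. [cite: MilnorHCobordism1965, Thm. 3.4 and its proof] -/
def collarChart [Nonempty (RegularLevel h)] : OpenPartialHomeomorph (RegularLevel h × ℝ) M where
  toFun p := U.fl (RegularLevel.incl h p.1) p.2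
  invFun x := (U.dropLift h x, f x - a)
  source := univ ×ˢ Ioo (-U.δ) U.δ
  target := U.band
  map_source' p hp := U.fl_mem_band p.1.2 hp.2
  map_target' x hx := by
    have h1 : a - U.δ < f x := hx.1
    have h2 : f x < a + U.δ := hx.2
    exact ⟨mem_univ _, show f x - a ∈ Ioo (-U.δ) U.δ from ⟨by linarith, by linarith⟩⟩
  left_inv' p hp := by
    obtain ⟨y, s⟩ := p
    have hy : f (RegularLevel.incl h y) = a := y.2
    have hs : s ∈ Ioo (-U.δ) U.δ := hp.2
    have h1 : U.dropLift h (U.fl (RegularLevel.incl h y) s) = y := by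
      apply (RegularLevel.isEmbedding_incl h).injective
      rw [U.incl_dropLift h (U.fl_mem_band hy hs), U.drop_fl_of_apply_eq hy hs]
    have h2 : f (U.fl (RegularLevel.incl h y) s) - a = s := by
      rw [U.apply_fl_of_apply_eq hy hs]; ring
    rw [Prod.mk.injEq]
    exact ⟨h1, h2⟩
  right_inv' x hx := by
    show U.fl (RegularLevel.incl h (U.dropLift h x)) (f x - a) = x
    rw [U.incl_dropLift h hx, U.fl_drop x]
  open_source := isOpen_univ.prod isOpen_Ioo
  open_target := U.isOpen_band
  continuousOn_toFun :=
    (U.continuous_fl.comp ((RegularLevel.isEmbedding_incl h).continuous.prodMap continuous_id)).continuousOn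
  continuousOn_invFun :=
    (U.contMDiffOn_dropLift h).continuousOn.prodMk
      ((U.contMDiff_f.continuous.sub continuous_const).continuousOn)

/-- The product chart, as a function (definitional). [cite: MilnorHCobordism1965, Thm. 3.4 and its proof] -/
theorem collarChart_apply [Nonempty (RegularLevel h)] (p : RegularLevel h × ℝ) :
    U.collarChart h p = U.fl (RegularLevel.incl h p.1) p.2 := rfl

/-- The inverse of the product chart, as a function (definitional). [cite: MilnorHCobordism1965, Thm. 3.4 and its proof] -/
theorem collarChart_symm_apply [Nonempty (RegularLevel h)] (x : M) :
    (U.collarChart h).symm x = (U.dropLift h x, f x - a) := rfl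

/-- The source of the product chart (definitional). [cite: MilnorHCobordism1965, Thm. 3.4 and its proof] -/
theorem collarChart_source [Nonempty (RegularLevel h)] :
    (U.collarChart h).source = univ ×ˢ Ioo (-U.δ) U.δ := rfl

/-- The target of the product chart (definitional). [cite: MilnorHCobordism1965, Thm. 3.4 and its proof] -/
theorem collarChart_target [Nonempty (RegularLevel h)] : (U.collarChart h).target = U.band := rfl

/-- **In the product chart, `f = a + s`.** [cite: MilnorHCobordism1965, Thm. 3.4 and its proof] -/
theorem apply_collarChart [Nonempty (RegularLevel h)] {p : RegularLevel h × ℝ}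
    (hp : p ∈ (U.collarChart h).source) : f (U.collarChart h p) = a + p.2 :=
  U.apply_fl_of_apply_eq p.1.2 hp.2

/-- **The product chart is smooth** (on all of `f⁻¹(a) × ℝ`), for the product model
`(𝓡 n).prod 𝓘(ℝ, ℝ)`. [cite: MilnorHCobordism1965, Thm. 3.4 and its proof] -/
theorem contMDiff_collarChart [Nonempty (RegularLevel h)] :
    ContMDiff ((𝓡 n).prod 𝓘(ℝ, ℝ)) (𝓡 (n + 1)) ∞ (U.collarChart h) :=
  U.contMDiff_fl.comp ((RegularLevel.contMDiff_incl h).prodMap contMDiff_id)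

/-- The product chart is smooth on its source. [cite: MilnorHCobordism1965, Thm. 3.4 and its proof] -/
theorem contMDiffOn_collarChart [Nonempty (RegularLevel h)] :
    ContMDiffOn ((𝓡 n).prod 𝓘(ℝ, ℝ)) (𝓡 (n + 1)) ∞ (U.collarChart h) (U.collarChart h).source :=
  (U.contMDiff_collarChart h).contMDiffOn

/-- **The inverse of the product chart is smooth on the band.**
[cite: MilnorHCobordism1965, Thm. 3.4 and its proof] -/
theorem contMDiffOn_collarChart_symm [Nonempty (RegularLevel h)] :
    ContMDiffOn (𝓡 (n + 1)) ((𝓡 n).prod 𝓘(ℝ, ℝ)) ∞ (U.collarChart h).symm (U.collarChart h).target :=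
  (U.contMDiffOn_dropLift h).prodMk ((U.contMDiff_f.sub contMDiff_const).contMDiffOn)

end Chart

end LevelUnitField

/-- **The product neighbourhood theorem for a regular level of a function on a closed
manifold** (Milnor 1963, Thm. 3.1; Milnor 1965, Thm. 3.4; Matsumoto 2001, Thm. 2.31): if the
level `f⁻¹(a)` of the smooth function `f` on the compact manifold without boundary `M` carries
no critical point and is nonempty, then for some `δ > 0` there is an open partial homeomorphism
`Φ` from `f⁻¹(a) × ℝ` (the level as a smooth manifold, times `ℝ`) to `M`, with source
`f⁻¹(a) × (-δ, δ)` and target the open band `f⁻¹(a - δ, a + δ)`, which is `C^∞` with `C^∞`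
inverse, restricts to the inclusion on `f⁻¹(a) × {0}` and satisfies `f (Φ (y, s)) = a + s`.
[cite: Milnor1963, Thm. 3.1] [cite: MilnorHCobordism1965, Thm. 3.4 and its proof] -/
theorem IsRegularLevel.exists_collarChart {f : M → ℝ} {a : ℝ} (h : IsRegularLevel (𝓡 (n + 1)) f a)
    [Nonempty (RegularLevel h)] :
    ∃ (δ : ℝ) (Φ : OpenPartialHomeomorph (RegularLevel h × ℝ) M), 0 < δ ∧
      Φ.source = univ ×ˢ Ioo (-δ) δ ∧ Φ.target = f ⁻¹' Ioo (a - δ) (a + δ) ∧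
      ContMDiffOn ((𝓡 n).prod 𝓘(ℝ, ℝ)) (𝓡 (n + 1)) ∞ Φ Φ.source ∧
      ContMDiffOn (𝓡 (n + 1)) ((𝓡 n).prod 𝓘(ℝ, ℝ)) ∞ Φ.symm Φ.target ∧
      (∀ y : RegularLevel h, Φ (y, 0) = RegularLevel.incl h y) ∧
      ∀ p ∈ Φ.source, f (Φ p) = a + p.2 := by
  obtain ⟨U⟩ := h.exists_levelUnitField
  exact ⟨U.δ, U.collarChart h, U.δ_pos, rfl, rfl, U.contMDiffOn_collarChart h,
    U.contMDiffOn_collarChart_symm h, fun y => U.fl_zero _, fun p hp => U.apply_collarChart h hp⟩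

end Literature.Topology.FourManifolds

end
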